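import Literature.Barriers.CriticalPhenomena.WeaklySAWFlowContraction
import Literature.Barriers.CriticalPhenomena.WeaklySAWQuadraticFlowLipschitz
import HarnessLib

/-!
# [BBS-rg-flow, Theorem 1.4(i)] = BBS 2015, Theorem 7.2.1(i): existence AND uniqueness of the flow of
# `Φ = (ψ, φ̄ + ρ)` with the bounds (1.11)–(1.14), with explicit thresholds `𝗁_*` and `g_*`

Thirteenth file of the series formalising [BBS-rg-flow] (Bauerschmidt–Brydges–Slade, AHP 16 (2015),
arXiv:1211.2477), the abstract dynamical-system input of BBS 2015, Theorem 4.1 (via its Theorem 7.2.1),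
towards `Literature.Barriers.CriticalPhenomena.WeaklySAWFourDimLogCorrections`; continuation of
`WeaklySAWFlowContraction.lean` (`exists_perturbedFlow`: the flow exists under `BallHyp` + `SmallHyp`)
and `WeaklySAWQuadraticFlowLipschitz.lean` (uniqueness for the backward linear recursions).

This file first proves the UNIQUENESS CLAUSE in conditional form — a competitor flow with the boundary
conditions and the bounds scales back (`unscale`) into the ball and is a fixed point of `T`
(`Tmap_eq_of_flow`: the `𝒦`-row directly, the `𝒱`-rows by uniqueness of the linear problem — `g`-row
forward from `0`, `z`-row `homZ_eq_zero`, `μ`-row `homMu_eq_zero`), hence equals the solution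
(`perturbedFlow_unique`, via `fixedPoint_unique`) — and then discharges the conditional hypotheses
from (A1)–(A3) alone, producing the printed statement:
* elementary bounds `g|log g| ≤ 2√g`, `2g log²(2g) ≤ 16√(2g)`, `(1-2Bg)⁻³ ≤ q` for `6Bg ≤ 1 - q⁻¹`;
* the margin `q₀ = min(2, (a_*-R)/(κa_*Ω), 1 + (1-κΩ)/(4κΩ)) > 1` (this is where `a_* > R/(1-κΩ)` and
  `κ < Ω⁻¹` enter), the thresholds `𝗁_* = hThreshold` (`= max(1, 16C'M(a-a_*)Ω, 2C'M/((1-κΩ)b))`,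
  `C' = (27/8)C_S̄`, depending only on the constants of (A1)–(A3) and `a_*, b`) and
  `g_* = gThreshold` (depending on the same and on `𝗁`; positive by `gThreshold_pos`);
* **`BBS_thm14_exists_flow`**: for `1 < Ω`, `0 < κ`, `κΩ < 1`, `0 < R`, `0 < M`, `R/(1-κΩ) < a_* < a`,
  `0 < b < 1`, every `𝗁 ≥ 𝗁_*`, every sequence of real Banach spaces `𝒲_j`, every system obeying
  (A1)–(A2) (`HypA1`, `HypA2`) and (A3) with parameters `(a, 𝗁, κ, Ω, R, M)` along `V̄(g₀)`, every
  `g₀ ∈ (0, g_*]` and `‖K₀‖ ≤ a_*g₀³`: there is a global flow `x` of `Φ` in `∏_j D_j` with `K₀`, `g₀`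
  prescribed, `(z_∞, μ_∞) = (0,0)` and the bounds (1.11)–(1.14), and it is the UNIQUE flow with these
  boundary conditions and bounds — with `θ = (1+κΩ)/2` the contraction rate of the flow map.

Deliberately NOT here: the neighbourhood `𝓘` with Remark 1.5, part (ii) (regularity in `(K₀, g₀)`).

## References
* R. Bauerschmidt, D. C. Brydges, G. Slade, *Structural stability of a dynamical system near a
  non-hyperbolic fixed point*, Ann. Henri Poincaré 16 (2015), arXiv:1211.2477: Theorem 1.4(i),
  Lemma 1.3, Lemma 2.2, Lemma 3.3, §3.4, Lemma 4.2. [BauerschmidtBrydgesSlade2015Flow]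
* R. Bauerschmidt, D. C. Brydges, G. Slade, CMP 338 (2015), Theorem 7.2.1(i). [BauerschmidtBrydgesSlade2015LogCorr]
-/

noncomputable section

open Filter Topology Set
open scoped BigOperators ENNReal NNReal

namespace Literature.Barriers.CriticalPhenomena

namespace CTWSAW

/-! ## The uniqueness clause of Theorem 1.4(i): a flow with the boundary conditions and the bounds
(1.11)–(1.14) is the fixed point -/

section Unscale

variable {W : ℕ → Type*} [∀ j, NormedAddCommGroup (W j)] [∀ j, NormedSpace ℝ (W j)]

/-- Scaling back a physical sequence to the coordinates of `X^𝗐`: `K̃_j = 𝗐_{K,j}⁻¹(K_j - K̄_j)`,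
`Ṽ_j = (𝗐_{g,j}⁻¹(g_j - g̊_j), 𝗐_{z,j}⁻¹(z_j - z̄_j), 𝗐_{μ,j}⁻¹(μ_j - μ̄_j))`. [cite: BauerschmidtBrydgesSlade2015Flow, §3.2] -/
def unscale (P : QuadFlowParams) (ψ : ∀ j, W j × V3 → W (j + 1)) (Ω : ℝ) (k : ℕ∞) (g₀ hh aK : ℝ) (K₀ : W 0)
    (x : ∀ j, W j × V3) : (∀ j, W j) × (ℕ → V3) :=
  (fun j => (P.wK g₀ Ω k aK j)⁻¹ • ((x j).1 - Kbar ψ (P.flow g₀) K₀ j),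
    fun j => ![(P.wG g₀ hh j)⁻¹ * ((x j).2 0 - P.flow g₀ j 0), (P.wZ g₀ Ω k hh j)⁻¹ * ((x j).2 1 - P.flow g₀ j 1),
      (P.wZ g₀ Ω k hh j)⁻¹ * ((x j).2 2 - P.flow g₀ j 2)])

/-- Unfolding, `𝒦`-part. [cite: BauerschmidtBrydgesSlade2015Flow, §3.2] -/
theorem unscale_fst (P : QuadFlowParams) (ψ : ∀ j, W j × V3 → W (j + 1)) (Ω : ℝ) (k : ℕ∞) (g₀ hh aK : ℝ)
    (K₀ : W 0) (x : ∀ j, W j × V3) (j : ℕ) :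
    (unscale P ψ Ω k g₀ hh aK K₀ x).1 j = (P.wK g₀ Ω k aK j)⁻¹ • ((x j).1 - Kbar ψ (P.flow g₀) K₀ j) := rfl

/-- Unfolding, `g`-coordinate. [cite: BauerschmidtBrydgesSlade2015Flow, §3.2] -/
theorem unscale_snd_zero (P : QuadFlowParams) (ψ : ∀ j, W j × V3 → W (j + 1)) (Ω : ℝ) (k : ℕ∞) (g₀ hh aK : ℝ)
    (K₀ : W 0) (x : ∀ j, W j × V3) (j : ℕ) :
    (unscale P ψ Ω k g₀ hh aK K₀ x).2 j 0 = (P.wG g₀ hh j)⁻¹ * ((x j).2 0 - P.flow g₀ j 0) := rfl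

/-- Unfolding, `z`-coordinate. [cite: BauerschmidtBrydgesSlade2015Flow, §3.2] -/
theorem unscale_snd_one (P : QuadFlowParams) (ψ : ∀ j, W j × V3 → W (j + 1)) (Ω : ℝ) (k : ℕ∞) (g₀ hh aK : ℝ)
    (K₀ : W 0) (x : ∀ j, W j × V3) (j : ℕ) :
    (unscale P ψ Ω k g₀ hh aK K₀ x).2 j 1 = (P.wZ g₀ Ω k hh j)⁻¹ * ((x j).2 1 - P.flow g₀ j 1) := rfl

/-- Unfolding, `μ`-coordinate. [cite: BauerschmidtBrydgesSlade2015Flow, §3.2] -/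
theorem unscale_snd_two (P : QuadFlowParams) (ψ : ∀ j, W j × V3 → W (j + 1)) (Ω : ℝ) (k : ℕ∞) (g₀ hh aK : ℝ)
    (K₀ : W 0) (x : ∀ j, W j × V3) (j : ℕ) :
    (unscale P ψ Ω k g₀ hh aK K₀ x).2 j 2 = (P.wZ g₀ Ω k hh j)⁻¹ * ((x j).2 2 - P.flow g₀ j 2) := rfl

end Unscale

namespace CutoffQuadHyp

variable {P : QuadFlowParams} {Ω : ℝ} {k : ℕ∞} {B c : ℝ} {N : ℕ} {C lam g₀ : ℝ}
  (h : CutoffQuadHyp P Ω k B c N C lam g₀)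
include h

variable {W : ℕ → Type*} [∀ j, NormedAddCommGroup (W j)] [∀ j, NormedSpace ℝ (W j)]
  {ψ : ∀ j, W j × V3 → W (j + 1)} {ρ : ∀ j, W j × V3 → V3} {a hh κ R M aStar b : ℝ} {K₀ : W 0}

/-- Scaling back inverts the embedding: `physX_j(unscale(x)_j) = x_j`. [cite: BauerschmidtBrydgesSlade2015Flow, §3.2] -/
theorem physX_unscale (hB : BallHyp P ψ Ω k g₀ hh a aStar b K₀) (x : ∀ j, W j × V3) (j : ℕ) :
    physX P ψ Ω k g₀ hh (a - aStar) K₀ j ((unscale P ψ Ω k g₀ hh (a - aStar) K₀ x).1 j,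
      (unscale P ψ Ω k g₀ hh (a - aStar) K₀ x).2 j) = x j := by
  have haK : 0 < a - aStar := by linarith [hB.aStar_lt]
  have hK : P.wK g₀ Ω k (a - aStar) j ≠ 0 := (h.wK_pos haK j).ne'
  have hG : P.wG g₀ hh j ≠ 0 := (h.wG_pos hB.hh_pos j).ne'
  have hZ : P.wZ g₀ Ω k hh j ≠ 0 := (h.wZ_pos hB.hh_pos j).ne'
  refine Prod.ext ?_ ?_
  · simp only [physX, unscale_fst, smul_inv_smul₀ hK]; abel
  · ext i
    fin_cases i
    · show (P.flow g₀ j + physV P Ω k g₀ hh j ((unscale P ψ Ω k g₀ hh (a - aStar) K₀ x).2 j)) 0 = (x j).2 0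
      rw [Pi.add_apply, physV_apply_zero, unscale_snd_zero, mul_inv_cancel_left₀ hG]; abel
    · show (P.flow g₀ j + physV P Ω k g₀ hh j ((unscale P ψ Ω k g₀ hh (a - aStar) K₀ x).2 j)) 1 = (x j).2 1
      rw [Pi.add_apply, physV_apply_one, unscale_snd_one, mul_inv_cancel_left₀ hZ]; abel
    · show (P.flow g₀ j + physV P Ω k g₀ hh j ((unscale P ψ Ω k g₀ hh (a - aStar) K₀ x).2 j)) 2 = (x j).2 2
      rw [Pi.add_apply, physV_apply_two, unscale_snd_two, mul_inv_cancel_left₀ hZ]; abel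

/-- A sequence obeying the bounds (1.11)–(1.14) scales back into the `b`-ball, coordinatewise.
[cite: BauerschmidtBrydgesSlade2015Flow, §3.2 ("the bounds are equivalent to x ∈ x̄ + b𝔹")] -/
theorem norm_unscale_le (hB : BallHyp P ψ Ω k g₀ hh a aStar b K₀) {x : ∀ j, W j × V3}
    (hx : FlowBounds (cutoffWeight Ω k) ψ (P.flow g₀) K₀ a aStar hh b x) (j : ℕ) :
    ‖(unscale P ψ Ω k g₀ hh (a - aStar) K₀ x).1 j‖ ≤ b ∧ ‖(unscale P ψ Ω k g₀ hh (a - aStar) K₀ x).2 j‖ ≤ b := by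
  have haK : 0 < a - aStar := by linarith [hB.aStar_lt]
  have hK := h.wK_pos haK j; have hG := h.wG_pos hB.hh_pos j; have hZ := h.wZ_pos hB.hh_pos j
  obtain ⟨b1, b2, b3, b4⟩ := hx j
  have hb := hB.b_pos.le
  constructor
  · rw [unscale_fst, norm_smul, norm_inv, Real.norm_eq_abs, abs_of_pos hK, inv_mul_le_iff₀ hK]
    calc ‖(x j).1 - Kbar ψ (P.flow g₀) K₀ j‖ ≤ b * (a - aStar) * cutoffWeight Ω k j * P.flow g₀ j 0 ^ 3 := b1
      _ = P.wK g₀ Ω k (a - aStar) j * b := by unfold QuadFlowParams.wK; rw [QuadFlowParams.flow_apply_zero]; ring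
  · refine norm_V3_le hb ?_ ?_ ?_
    · rw [unscale_snd_zero, abs_mul, abs_inv, abs_of_pos hG, inv_mul_le_iff₀ hG]
      calc |(x j).2 0 - P.flow g₀ j 0| ≤ b * hh * P.flow g₀ j 0 ^ 2 * |Real.log (P.flow g₀ j 0)| := b2
        _ = P.wG g₀ hh j * b := by unfold QuadFlowParams.wG; rw [QuadFlowParams.flow_apply_zero]; ring
    · rw [unscale_snd_one, abs_mul, abs_inv, abs_of_pos hZ, inv_mul_le_iff₀ hZ]
      calc |(x j).2 1 - P.flow g₀ j 1| ≤ b * hh * cutoffWeight Ω k j * P.flow g₀ j 0 ^ 2 * |Real.log (P.flow g₀ j 0)| := b3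
        _ = P.wZ g₀ Ω k hh j * b := by unfold QuadFlowParams.wZ; rw [QuadFlowParams.flow_apply_zero]; ring
    · rw [unscale_snd_two, abs_mul, abs_inv, abs_of_pos hZ, inv_mul_le_iff₀ hZ]
      calc |(x j).2 2 - P.flow g₀ j 2| ≤ b * hh * cutoffWeight Ω k j * P.flow g₀ j 0 ^ 2 * |Real.log (P.flow g₀ j 0)| := b4
        _ = P.wZ g₀ Ω k hh j * b := by unfold QuadFlowParams.wZ; rw [QuadFlowParams.flow_apply_zero]; ring

/-- The scaled-back sequence as a point of the ball of `ℓ^∞(∏𝒲_j) × ℓ^∞(ℝ³)`.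
[cite: BauerschmidtBrydgesSlade2015Flow, §3.2] -/
theorem unscale_mem (hB : BallHyp P ψ Ω k g₀ hh a aStar b K₀) {x : ∀ j, W j × V3}
    (hx : FlowBounds (cutoffWeight Ω k) ψ (P.flow g₀) K₀ a aStar hh b x) :
    ∃ y ∈ scaledBall W b, ((y.1 : ∀ j, W j) = (unscale P ψ Ω k g₀ hh (a - aStar) K₀ x).1) ∧
      ((y.2 : ℕ → V3) = (unscale P ψ Ω k g₀ hh (a - aStar) K₀ x).2) := by
  have h1 := fun j => (h.norm_unscale_le hB hx j).1
  have h2 := fun j => (h.norm_unscale_le hB hx j).2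
  refine ⟨(⟨_, memℓp_of_forall_norm_le h1⟩, ⟨_, memℓp_of_forall_norm_le h2⟩), ⟨?_, ?_⟩, rfl, rfl⟩
  · exact lp.norm_le_of_forall_le hB.b_pos.le h1
  · exact lp.norm_le_of_forall_le hB.b_pos.le h2

/-- **A competitor is a fixed point**: if `x'` is a flow of `Φ` with `K₀`, `g₀` prescribed, `(z_j, μ_j) → 0`
and the bounds (1.11)–(1.14), then its scaled-back coordinates `ỹ'` satisfy `Tỹ' = ỹ'` (the `𝒦`-row
directly; the `𝒱`-rows by uniqueness of the linear problem: the `g`-row forward from `0`, the `z`-row by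
Lemma 2.1(iii)(b), the `μ`-row because the direction expands). [cite: BauerschmidtBrydgesSlade2015Flow, Theorem 1.4(i) (uniqueness clause) and Lemmas 2.2, 4.2] -/
theorem Tmap_eq_of_flow (hA : HypA3 (cutoffWeight Ω k) ψ ρ (P.flow g₀) a hh κ Ω R M)
    (hB : BallHyp P ψ Ω k g₀ hh a aStar b K₀) {x : ∀ j, W j × V3} (hflow : IsPerturbedFlow P ψ ρ x)
    (hK0 : (x 0).1 = K₀) (hg0 : (x 0).2 0 = g₀) (hz : Tendsto (fun j => (x j).2 1) atTop (𝓝 0))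
    (hμ : Tendsto (fun j => (x j).2 2) atTop (𝓝 0))
    {y : SeqK W × SeqV} (hy : y ∈ scaledBall W b)
    (hy1 : (y.1 : ∀ j, W j) = (unscale P ψ Ω k g₀ hh (a - aStar) K₀ x).1)
    (hy2 : (y.2 : ℕ → V3) = (unscale P ψ Ω k g₀ hh (a - aStar) K₀ x).2) :
    Tmap P ψ ρ Ω k g₀ hh (a - aStar) K₀ (h.sbarVP hB.small1 hB.hh_pos) y = y := by
  have haK : 0 < a - aStar := by linarith [hB.aStar_lt]
  -- the physical sequence of `y` is `x`
  have hphys : ∀ j, physX P ψ Ω k g₀ hh (a - aStar) K₀ j ((y.1 : ∀ j, W j) j, (y.2 : ℕ → V3) j) = x j := by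
    intro j; rw [hy1, hy2]; exact h.physX_unscale hB x j
  refine Prod.ext ?_ ?_
  · -- the `𝒦`-row
    apply lp.ext
    rw [h.coe_Tmap_fst hA hB _ hy]
    funext j
    cases j with
    | zero =>
      rw [TK_zero, hy1, unscale_fst, hK0, Kbar_zero, sub_self, smul_zero]
    | succ j =>
      rw [TK_succ, hphys j, hy1, unscale_fst, (Prod.ext_iff.1 (hflow j)).1, Kbar_succ]
      rfl
  · -- the `𝒱`-rows: both `y.2` and `S̄(Ñ y)` solve the same linear problem
    set r : SeqV := toSeqV (srcN P ψ ρ Ω k g₀ hh (a - aStar) K₀ ((y.1 : ∀ j, W j), (y.2 : ℕ → V3))) with hr_def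
    have hr : (r : ℕ → V3) = srcN P ψ ρ Ω k g₀ hh (a - aStar) K₀ ((y.1 : ∀ j, W j), (y.2 : ℕ → V3)) :=
      h.coe_toSeqV_srcN hA hB hy
    show h.sbarVP hB.small1 hB.hh_pos r = y.2
    obtain ⟨⟨u0, ug, uz, uμ⟩, tz, tμ⟩ := h.sbarVP_solves hB.small1 hB.hh_pos r
    have hv : ∀ j, P.vV g₀ Ω k hh (j + 1) ≠ 0 := fun j => (h.vV_pos hB.hh_pos (j + 1)).ne'
    have hwG : ∀ j, P.wG g₀ hh j ≠ 0 := fun j => (h.wG_pos hB.hh_pos j).ne'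
    have hwZ : ∀ j, P.wZ g₀ Ω k hh j ≠ 0 := fun j => (h.wZ_pos hB.hh_pos j).ne'
    -- the physical source at position `j+1`
    have hsrc : ∀ j (i : Fin 3), P.vV g₀ Ω k hh (j + 1) * (r : ℕ → V3) (j + 1) i =
        (P.quadRem j (P.flow g₀ j) ((x j).2 - P.flow g₀ j) + ρ j (x j)) i := by
      intro j i
      have hd : physV P Ω k g₀ hh j ((y.2 : ℕ → V3) j) = (x j).2 - P.flow g₀ j := by
        have := congrArg Prod.snd (hphys j)
        simp only [physX] at this
        rw [← this]; abel
      rw [hr, srcN_succ, Pi.smul_apply, smul_eq_mul, ← mul_assoc, mul_inv_cancel₀ (hv j), one_mul, hphys j, hd]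
    -- the `𝒱`-flow equation in increment form: `d_{j+1} = L_jd_j + [Q_j(d_j) + ρ_j(x_j)]`
    have hflowV : ∀ j, (x (j + 1)).2 - P.flow g₀ (j + 1) =
        P.dmap j (P.flow g₀ j) ((x j).2 - P.flow g₀ j) +
          (P.quadRem j (P.flow g₀ j) ((x j).2 - P.flow g₀ j) + ρ j (x j)) := by
      intro j
      rw [(Prod.ext_iff.1 (hflow j)).2, (h.isQuadFlowBC_flow).1 j]
      simp only [QuadFlowParams.quadRem, add_sub_cancel]
      abel
    have eqc : ∀ j (i : Fin 3), (x (j + 1)).2 i - P.flow g₀ (j + 1) i =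
        P.dmap j (P.flow g₀ j) ((x j).2 - P.flow g₀ j) i + P.vV g₀ Ω k hh (j + 1) * (r : ℕ → V3) (j + 1) i := by
      intro j i
      have := congrFun (hflowV j) i
      simp only [Pi.sub_apply, Pi.add_apply] at this
      rw [this, hsrc j i, Pi.add_apply]
    have d0 : ∀ j, P.dmap j (P.flow g₀ j) ((x j).2 - P.flow g₀ j) 0 = P.aCoef g₀ j * ((x j).2 0 - P.flow g₀ j 0) :=
      fun j => (P.dmap_flow_apply j g₀ _).1
    have d1 : ∀ j, P.dmap j (P.flow g₀ j) ((x j).2 - P.flow g₀ j) 1 =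
        -P.xiT g₀ j * ((x j).2 0 - P.flow g₀ j 0) + P.czCoef g₀ j * ((x j).2 1 - P.flow g₀ j 1) :=
      fun j => (P.dmap_flow_apply j g₀ _).2.1
    have d2 : ∀ j, P.dmap j (P.flow g₀ j) ((x j).2 - P.flow g₀ j) 2 =
        P.etaT g₀ j * ((x j).2 0 - P.flow g₀ j 0) + P.gammaT g₀ j * ((x j).2 1 - P.flow g₀ j 1) +
          P.lamT g₀ j * ((x j).2 2 - P.flow g₀ j 2) :=
      fun j => (P.dmap_flow_apply j g₀ _).2.2
    -- the `g`-row: forward induction from `0`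
    have hGG : ∀ j, (x j).2 0 - P.flow g₀ j 0 = P.wG g₀ hh j * (h.sbarVP hB.small1 hB.hh_pos r : ℕ → V3) j 0 := by
      intro j
      induction j with
      | zero => rw [u0, hg0, QuadFlowParams.flow_apply_zero, gbar_zero, sub_self]
      | succ j ih => rw [eqc, d0, ug, ih]
    -- the `z`-row: the difference is a decaying homogeneous solution
    have hZZ : ∀ j, (x j).2 1 - P.flow g₀ j 1 = P.wZ g₀ Ω k hh j * (h.sbarVP hB.small1 hB.hh_pos r : ℕ → V3) j 1 := by
      have hD : ∀ j, ((x (j + 1)).2 1 - P.flow g₀ (j + 1) 1 -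
          P.wZ g₀ Ω k hh (j + 1) * (h.sbarVP hB.small1 hB.hh_pos r : ℕ → V3) (j + 1) 1) =
          (1 - P.ζ j * gbar P.β g₀ j) *
            ((x j).2 1 - P.flow g₀ j 1 - P.wZ g₀ Ω k hh j * (h.sbarVP hB.small1 hB.hh_pos r : ℕ → V3) j 1) := by
        intro j; rw [eqc, d1, uz, hGG]; simp only [QuadFlowParams.czCoef]; ring
      have hD0 : Tendsto (fun j => (x j).2 1 - P.flow g₀ j 1 -
          P.wZ g₀ Ω k hh j * (h.sbarVP hB.small1 hB.hh_pos r : ℕ → V3) j 1) atTop (𝓝 0) := by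
        have t1 : Tendsto (fun j => (x j).2 1 - P.flow g₀ j 1) atTop (𝓝 0) := by
          simpa using hz.sub h.tendsto_zbar_zero
        simpa using t1.sub tz
      intro j
      have := h.homZ_eq_zero hD hD0 j
      linarith
    -- the `μ`-row: the difference is a bounded homogeneous solution of the expanding recursion
    have hMM : ∀ j, (x j).2 2 - P.flow g₀ j 2 = P.wZ g₀ Ω k hh j * (h.sbarVP hB.small1 hB.hh_pos r : ℕ → V3) j 2 := by
      have hD : ∀ j, ((x (j + 1)).2 2 - P.flow g₀ (j + 1) 2 -
          P.wZ g₀ Ω k hh (j + 1) * (h.sbarVP hB.small1 hB.hh_pos r : ℕ → V3) (j + 1) 2) =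
          (P.lam j - P.tau g₀ j) *
            ((x j).2 2 - P.flow g₀ j 2 - P.wZ g₀ Ω k hh j * (h.sbarVP hB.small1 hB.hh_pos r : ℕ → V3) j 2) := by
        intro j; rw [eqc, d2, uμ, hGG, hZZ, ← P.lamT_eq]; ring
      have hD0 : Tendsto (fun j => (x j).2 2 - P.flow g₀ j 2 -
          P.wZ g₀ Ω k hh j * (h.sbarVP hB.small1 hB.hh_pos r : ℕ → V3) j 2) atTop (𝓝 0) := by
        have t1 : Tendsto (fun j => (x j).2 2 - P.flow g₀ j 2) atTop (𝓝 0) := by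
          simpa using hμ.sub h.tendsto_mubar_zero
        simpa using t1.sub tμ
      have hbdd : ∃ R, ∀ j, |(x j).2 2 - P.flow g₀ j 2 -
          P.wZ g₀ Ω k hh j * (h.sbarVP hB.small1 hB.hh_pos r : ℕ → V3) j 2| ≤ R := by
        obtain ⟨R, hR⟩ := (hD0.abs).bddAbove_range
        exact ⟨R, fun j => hR ⟨j, rfl⟩⟩
      intro j
      have := h.homMu_eq_zero hD hbdd j
      linarith
    -- conclude: `y.2 = S̄(Ñ y)` coordinatewise
    apply lp.ext
    funext j
    rw [hy2]
    ext i
    fin_cases i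
    · show (h.sbarVP hB.small1 hB.hh_pos r : ℕ → V3) j 0 = (unscale P ψ Ω k g₀ hh (a - aStar) K₀ x).2 j 0
      rw [unscale_snd_zero, hGG j, inv_mul_cancel_left₀ (hwG j)]
    · show (h.sbarVP hB.small1 hB.hh_pos r : ℕ → V3) j 1 = (unscale P ψ Ω k g₀ hh (a - aStar) K₀ x).2 j 1
      rw [unscale_snd_one, hZZ j, inv_mul_cancel_left₀ (hwZ j)]
    · show (h.sbarVP hB.small1 hB.hh_pos r : ℕ → V3) j 2 = (unscale P ψ Ω k g₀ hh (a - aStar) K₀ x).2 j 2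
      rw [unscale_snd_two, hMM j, inv_mul_cancel_left₀ (hwZ j)]

/-- **[BBS-rg-flow, Theorem 1.4(i), uniqueness clause, conditional form]**: under the hypotheses of
`exists_perturbedFlow`, any two flows of `Φ` with `K₀`, `g₀` prescribed, `(z_j, μ_j) → (0,0)` and the
bounds (1.11)–(1.14) coincide. [cite: BauerschmidtBrydgesSlade2015Flow, Theorem 1.4(i) ("The sequence x is the unique solution … which obeys these boundary conditions and the bounds")] -/
theorem perturbedFlow_unique (hA : HypA3 (cutoffWeight Ω k) ψ ρ (P.flow g₀) a hh κ Ω R M)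
    (hB : BallHyp P ψ Ω k g₀ hh a aStar b K₀) {θ : ℝ}
    (hS : SmallHyp Ω B C g₀ κ M hh (a - aStar) b θ (h.sbarVP hB.small1 hB.hh_pos))
    {x x' : ∀ j, W j × V3}
    (hx : IsPerturbedFlow P ψ ρ x) (hx0 : (x 0).1 = K₀) (hxg : (x 0).2 0 = g₀)
    (hxz : Tendsto (fun j => (x j).2 1) atTop (𝓝 0)) (hxμ : Tendsto (fun j => (x j).2 2) atTop (𝓝 0))
    (hxb : FlowBounds (cutoffWeight Ω k) ψ (P.flow g₀) K₀ a aStar hh b x)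
    (hx' : IsPerturbedFlow P ψ ρ x') (hx0' : (x' 0).1 = K₀) (hxg' : (x' 0).2 0 = g₀)
    (hxz' : Tendsto (fun j => (x' j).2 1) atTop (𝓝 0)) (hxμ' : Tendsto (fun j => (x' j).2 2) atTop (𝓝 0))
    (hxb' : FlowBounds (cutoffWeight Ω k) ψ (P.flow g₀) K₀ a aStar hh b x') : x = x' := by
  obtain ⟨y, hy, hy1, hy2⟩ := h.unscale_mem hB hxb
  obtain ⟨y', hy', hy1', hy2'⟩ := h.unscale_mem hB hxb'
  have hf := h.Tmap_eq_of_flow hA hB hx hx0 hxg hxz hxμ hy hy1 hy2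
  have hf' := h.Tmap_eq_of_flow hA hB hx' hx0' hxg' hxz' hxμ' hy' hy1' hy2'
  have hyy : y = y' := h.fixedPoint_unique hA hB hS hy hy' hf hf'
  funext j
  have e1 := h.physX_unscale hB x j
  have e2 := h.physX_unscale hB x' j
  rw [← hy1, ← hy2] at e1
  rw [← hy1', ← hy2'] at e2
  rw [← e1, ← e2, hyy]

end CutoffQuadHyp


/-! ## The thresholds `𝗁_*` and `g_*`: discharging `BallHyp` and `SmallHyp` from (A1)–(A3), and
Theorem 1.4(i) (existence with bounds) in the printed quantifier shape -/

/-- `ε₁(g) = g|log g| ≤ 2√g` on `(0, 1]`. [folklore] -/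
theorem epsLog_le_sqrt {g : ℝ} (hg : 0 < g) (hg1 : g ≤ 1) : epsLog g ≤ 2 * Real.sqrt g := by
  set s := Real.sqrt g with hs
  have hs0 : 0 < s := Real.sqrt_pos.2 hg
  have hs1 : s ≤ 1 := by rw [hs, Real.sqrt_le_one]; exact hg1
  have hg' : g = s ^ 2 := (Real.sq_sqrt hg.le).symm
  have hlog : Real.log g = 2 * Real.log s := by
    rw [hg', Real.log_pow]; norm_num
  have hsl : s * |Real.log s| ≤ 1 := by
    have := Real.abs_log_mul_self_lt s hs0 hs1
    rw [abs_mul, abs_of_pos hs0] at this; linarith [this]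
  unfold epsLog
  rw [hlog, abs_mul, abs_of_pos (by norm_num : (0:ℝ) < 2), hg']
  nlinarith [abs_nonneg (Real.log s)]

/-- `ε₂(g) = 2g log²(2g) ≤ 16√(2g)` for `2g ≤ 1`. [folklore] -/
theorem epsLogSq_le_sqrt {g : ℝ} (hg : 0 < g) (hg1 : 2 * g ≤ 1) : epsLogSq g ≤ 16 * Real.sqrt (2 * g) := by
  set t := 2 * g with ht
  have ht0 : 0 < t := by positivity
  set s := Real.sqrt (Real.sqrt t) with hs
  have hs0 : 0 < s := Real.sqrt_pos.2 (Real.sqrt_pos.2 ht0)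
  have hs1 : s ≤ 1 := by
    rw [hs, Real.sqrt_le_one, Real.sqrt_le_one]; exact hg1
  have hs2 : s ^ 2 = Real.sqrt t := Real.sq_sqrt (Real.sqrt_nonneg _)
  have hs4 : s ^ 4 = t := by
    calc s ^ 4 = (s ^ 2) ^ 2 := by ring
      _ = t := by rw [hs2, Real.sq_sqrt ht0.le]
  have hlog : Real.log t = 4 * Real.log s := by
    rw [← hs4, Real.log_pow]; norm_num
  have hsl : (s * Real.log s) ^ 2 ≤ 1 := by
    have := Real.abs_log_mul_self_lt s hs0 hs1
    rw [mul_comm] at this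
    have h0 : |s * Real.log s| ≤ 1 := this.le
    calc (s * Real.log s) ^ 2 = |s * Real.log s| ^ 2 := (sq_abs _).symm
      _ ≤ 1 ^ 2 := pow_le_pow_left₀ (abs_nonneg _) h0 2
      _ = 1 := one_pow 2
  unfold epsLogSq
  rw [← ht, hlog, ← hs2]
  calc t * (4 * Real.log s) ^ 2 = 16 * s ^ 2 * (s * Real.log s) ^ 2 := by rw [← hs4]; ring
    _ ≤ 16 * s ^ 2 * 1 := by gcongr
    _ = 16 * s ^ 2 := mul_one _

/-- `(1 - 2Bg)⁻³ ≤ q` as soon as `6Bg ≤ 1 - q⁻¹` (`q ≥ 1`, `B ≥ 0`): the one-step ratio `ϑ/Ω` is as close to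
`1` as needed for small `g₀`. [cite: BauerschmidtBrydgesSlade2015Flow, Lemma 1.3 (proof: "1 + O(g₀)")] -/
theorem inv_cube_le_of_small {B g q : ℝ} (hB : 0 ≤ B) (hg : 0 ≤ g) (hq : 1 ≤ q) (hsmall : 6 * B * g ≤ 1 - q⁻¹) :
    ((1 - 2 * B * g)⁻¹) ^ 3 ≤ q := by
  have hq0 : 0 < q := by linarith
  have hqi : 0 < q⁻¹ := inv_pos.2 hq0
  have hx : 2 * B * g ≤ 1 / 3 := by nlinarith [inv_nonneg.2 hq0.le]
  have hpos : 0 < 1 - 2 * B * g := by linarith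
  rw [inv_pow, inv_le_comm₀ (pow_pos hpos 3) hq0]
  have hx0 : 0 ≤ 2 * B * g := by positivity
  have hbern : 1 - 6 * B * g ≤ (1 - 2 * B * g) ^ 3 := by
    nlinarith [mul_nonneg (mul_nonneg hx0 hx0) (by linarith : (0:ℝ) ≤ 3 - 2 * B * g)]
  linarith

/-- The auxiliary ratio margin `q₀ = min(2, (a_*-R)/(κa_*Ω), 1 + (1-κΩ)/(4κΩ)) > 1` of the thresholds.
[cite: BauerschmidtBrydgesSlade2015Flow, Theorem 1.4 (the role of a_* > R/(1-κΩ) and κ < Ω⁻¹)] -/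
def ratioMargin (Ω κ R aStar : ℝ) : ℝ :=
  min (min 2 ((aStar - R) / (κ * aStar * Ω))) (1 + (1 - κ * Ω) / (4 * (κ * Ω)))

/-- `q₀ > 1`. [cite: BauerschmidtBrydgesSlade2015Flow, Theorem 1.4] -/
theorem one_lt_ratioMargin {Ω κ R aStar : ℝ} (hΩ : 0 < Ω) (hκ : 0 < κ) (hκΩ : κ * Ω < 1) (hR : 0 < R)
    (haStar : R / (1 - κ * Ω) < aStar) : 1 < ratioMargin Ω κ R aStar := by
  have h1 : 0 < 1 - κ * Ω := by linarith
  have ha0 : 0 < aStar := lt_trans (div_pos hR h1) haStar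
  have hkΩ : 0 < κ * Ω := mul_pos hκ hΩ
  unfold ratioMargin
  refine lt_min (lt_min (by norm_num) ?_) ?_
  · rw [lt_div_iff₀ (by positivity)]
    have : R < aStar * (1 - κ * Ω) := (div_lt_iff₀ h1).1 haStar
    nlinarith
  · have : 0 < (1 - κ * Ω) / (4 * (κ * Ω)) := div_pos h1 (by positivity)
    linarith

/-- **The threshold `𝗁_*`** of Theorem 1.4 (depending only on the constants of (A1)–(A3) and `a_*, b`):
`𝗁_* = max(1, 16C'M(a-a_*)Ω, 2C'M/((1-κΩ)b))`, `C' = (27/8)C_S̄`. [cite: BauerschmidtBrydgesSlade2015Flow, Theorem 1.4 ("there exists h_* > 0")] -/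
def hThreshold (Ω c C lam M a aStar κ b : ℝ) : ℝ :=
  max 1 (max (16 * (sbarConst Ω c ⌊c⁻¹⌋₊ C lam * (27 / 8)) * M * (a - aStar) * Ω)
    (2 * (sbarConst Ω c ⌊c⁻¹⌋₊ C lam * (27 / 8)) * M / ((1 - κ * Ω) * b)))

/-- **The threshold `g_*`** of Theorem 1.4 (depending on the constants, `a_*, b` and `𝗁`).
[cite: BauerschmidtBrydgesSlade2015Flow, Theorem 1.4 ("there exists g_* > 0")] -/
def gThreshold (Ω B c C lam M a aStar κ R b hh : ℝ) : ℝ :=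
  min (min (min (quadThreshold Ω B c C lam) (Real.exp (-2) / 4))
    ((1 - (ratioMargin Ω κ R aStar)⁻¹) / (6 * B + 1)))
    (min (((1 - κ * Ω) * (a - aStar) / (64 * M * hh)) ^ 2)
      ((1 / (8 * (sbarConst Ω c ⌊c⁻¹⌋₊ C lam * (27 / 8) + 1) * (512 * (2 * B + 14 * C) * Ω * hh * b + 8 * M))) ^ 2 / 2))

/-- `𝗁_* ≥ 1 > 0`. [cite: BauerschmidtBrydgesSlade2015Flow, Theorem 1.4] -/
theorem one_le_hThreshold (Ω c C lam M a aStar κ b : ℝ) : 1 ≤ hThreshold Ω c C lam M a aStar κ b := le_max_left _ _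

/-- `g_* > 0`. [cite: BauerschmidtBrydgesSlade2015Flow, Theorem 1.4] -/
theorem gThreshold_pos {Ω B c C lam M a aStar κ R b hh : ℝ} (hΩ : 1 < Ω) (hB : 0 ≤ B) (hc : 0 < c) (hlam : 1 < lam)
    (hC : 0 ≤ C) (hM : 0 < M) (ha : aStar < a) (hκ : 0 < κ) (hκΩ : κ * Ω < 1) (hR : 0 < R)
    (haStar : R / (1 - κ * Ω) < aStar) (hb : 0 < b) (hh0 : 0 < hh) :
    0 < gThreshold Ω B c C lam M a aStar κ R b hh := by
  have hq := one_lt_ratioMargin (by linarith) hκ hκΩ hR haStar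
  have hq0 : 0 < ratioMargin Ω κ R aStar := by linarith
  have hqi : (ratioMargin Ω κ R aStar)⁻¹ < 1 := inv_lt_one_of_one_lt₀ hq
  have h1 : 0 < 1 - κ * Ω := by linarith
  have h2 : 0 < a - aStar := by linarith
  have hS : 0 ≤ sbarConst Ω c ⌊c⁻¹⌋₊ C lam * (27 / 8) := by
    have : 0 ≤ sbarConst Ω c ⌊c⁻¹⌋₊ C lam := by
      unfold sbarConst; exact le_max_of_le_left (by unfold linGConst; have : 0 ≤ Ω / (Ω - 1) := div_nonneg (by linarith) (by linarith); positivity)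
    positivity
  have hBC : 0 ≤ 2 * B + 14 * C := by positivity
  have hΩ0 : 0 ≤ Ω := by linarith
  unfold gThreshold
  refine lt_min (lt_min (lt_min (quadThreshold_pos hΩ hc hlam) (by positivity)) ?_)
    (lt_min (pow_pos (div_pos (mul_pos h1 h2) (by positivity)) 2) ?_)
  · exact div_pos (by linarith) (by positivity)
  · have : 0 < 8 * (sbarConst Ω c ⌊c⁻¹⌋₊ C lam * (27 / 8) + 1) * (512 * (2 * B + 14 * C) * Ω * hh * b + 8 * M) := by positivity
    positivity


/-! ### Theorem 1.4(i) (existence, bounds, uniqueness) in the printed quantifier shape -/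

set_option maxHeartbeats 1600000 in
/-- **[BBS-rg-flow, Theorem 1.4(i): existence of the flow with the bounds (1.11)–(1.14)]** =
**BBS 2015, Theorem 7.2.1(i) (existence part)**, in the printed quantifier shape
"there exists `𝗁_*` (depending only on the constants of (A1)–(A3) and `a_*, b`) such that for all
`𝗁 ≥ 𝗁_*` there exists `g_* > 0` (`gThreshold`, positive by `gThreshold_pos`) such that if
`g₀ ∈ (0, g_*]` and `‖K₀‖ ≤ a_*g₀³` …": for every sequence of real Banach spaces `𝒲_j`, every system
`Φ = (ψ, φ̄ + ρ)` obeying (A1)–(A2) (`HypA1`, `HypA2`) and (A3) with parameters `(a, 𝗁, κ, Ω, R, M)`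
along the flow `V̄(g₀)` of Proposition 1.2 (`HypA3`), and every `a_* ∈ (R/(1-κΩ), a)`, `b ∈ (0,1)`,
there is a global flow `x = (K_j, V_j)_j` of `Φ` in `∏_j D_j(g₀, a, 𝗁)` with `K₀`, `g₀` prescribed,
`(z_∞, μ_∞) = (0, 0)`, obeying (1.11)–(1.14) against `x̄ = (K̄, V̄)`, and it is the UNIQUE flow with these
boundary conditions and bounds (here at the initial condition `(K₀, g₀)` itself; the neighbourhood `𝓘`
and part (ii) are not in this file).
Proof: Banach's fixed point theorem for the flow map `T` (`exists_perturbedFlow`) with the thresholds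
`hThreshold`, `gThreshold` making `T` a self-map and a contraction of the `b`-ball.
[cite: BauerschmidtBrydgesSlade2015Flow, Theorem 1.4(i)] [cite: BauerschmidtBrydgesSlade2015LogCorr, Theorem 7.2.1(i)] -/
theorem BBS_thm14_exists_flow {Ω B c lam C a κ R M aStar b : ℝ} (hΩ : 1 < Ω)
    (hκ : 0 < κ) (hκΩ : κ * Ω < 1) (hR : 0 < R) (hM : 0 < M) (haStar : R / (1 - κ * Ω) < aStar) (ha : aStar < a)
    (hb : 0 < b) (hb1 : b < 1) (hh : ℝ) (hhh : hThreshold Ω c C lam M a aStar κ b ≤ hh)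
    {W : ℕ → Type*} [∀ j, NormedAddCommGroup (W j)] [∀ j, NormedSpace ℝ (W j)] [∀ j, CompleteSpace (W j)]
    (P : QuadFlowParams) (ψ : ∀ j, W j × V3 → W (j + 1)) (ρ : ∀ j, W j × V3 → V3) {g₀ : ℝ} {K₀ : W 0}
    (hA1 : HypA1 P.β Ω B c) (hA2 : HypA2 P Ω lam c C) (hg₀ : 0 < g₀)
    (hgs : g₀ ≤ gThreshold Ω B c C lam M a aStar κ R b hh)
    (hA3 : HypA3 (chi P.β Ω) ψ ρ (P.flow g₀) a hh κ Ω R M) (hK₀ : ‖K₀‖ ≤ aStar * g₀ ^ 3) :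
    ∃ x : ∀ j, W j × V3,
      (∀ j, x j ∈ flowDomain (chi P.β Ω) (P.flow g₀) a hh j) ∧ IsPerturbedFlow P ψ ρ x ∧
      (x 0).1 = K₀ ∧ (x 0).2 0 = g₀ ∧
      Tendsto (fun j => (x j).2 1) atTop (𝓝 0) ∧ Tendsto (fun j => (x j).2 2) atTop (𝓝 0) ∧
      FlowBounds (chi P.β Ω) ψ (P.flow g₀) K₀ a aStar hh b x ∧
      ∀ x' : ∀ j, W j × V3, IsPerturbedFlow P ψ ρ x' → (x' 0).1 = K₀ → (x' 0).2 0 = g₀ →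
        Tendsto (fun j => (x' j).2 1) atTop (𝓝 0) → Tendsto (fun j => (x' j).2 2) atTop (𝓝 0) →
        FlowBounds (chi P.β Ω) ψ (P.flow g₀) K₀ a aStar hh b x' → x' = x := by
  -- constants
  set C' : ℝ := sbarConst Ω c ⌊c⁻¹⌋₊ C lam * (27 / 8) with hC'
  set aK : ℝ := a - aStar with haK_def
  set q₀ : ℝ := ratioMargin Ω κ R aStar with hq₀
  set θ₀ : ℝ := (1 + κ * Ω) / 2 with hθ₀
  have hΩ0 : 0 < Ω := by linarith
  have h1κ : 0 < 1 - κ * Ω := by linarith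
  have haK : 0 < aK := by rw [haK_def]; linarith
  have ha0 : 0 < aStar := lt_trans (div_pos hR h1κ) haStar
  have hB : 0 ≤ B := hA1.B_nonneg
  -- thresholds for `𝗁`
  have hh1 : 1 ≤ hh := (le_max_left _ _).trans hhh
  have hh0 : 0 < hh := by linarith
  have hhA : 16 * C' * M * aK * Ω ≤ hh := ((le_max_left _ _).trans (le_max_right _ _)).trans hhh
  have hhB : 2 * C' * M / ((1 - κ * Ω) * b) ≤ hh := ((le_max_right _ _).trans (le_max_right _ _)).trans hhh
  -- thresholds for `g₀`
  have hgq : g₀ ≤ quadThreshold Ω B c C lam :=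
    hgs.trans ((min_le_left _ _).trans ((min_le_left _ _).trans (min_le_left _ _)))
  have hge : g₀ ≤ Real.exp (-2) / 4 :=
    hgs.trans ((min_le_left _ _).trans ((min_le_left _ _).trans (min_le_right _ _)))
  have hgr : g₀ ≤ (1 - q₀⁻¹) / (6 * B + 1) := hgs.trans ((min_le_left _ _).trans (min_le_right _ _))
  have hg3 : g₀ ≤ ((1 - κ * Ω) * aK / (64 * M * hh)) ^ 2 := hgs.trans ((min_le_right _ _).trans (min_le_left _ _))
  have hg4 : g₀ ≤ (1 / (8 * (C' + 1) * (512 * (2 * B + 14 * C) * Ω * hh * b + 8 * M))) ^ 2 / 2 :=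
    hgs.trans ((min_le_right _ _).trans (min_le_right _ _))
  -- (A1)–(A2) ⇒ the hypotheses of Lemmas 2.1–2.2 at the cut-off `j_Ω`
  obtain ⟨h, -, -⟩ := cutoffQuadHyp_of_hypA hΩ hA1 hA2 hg₀ hgq
  have hC : 0 ≤ C := h.C_nonneg
  have hC'0 : 0 ≤ C' := mul_nonneg h.sbarConst_nonneg (by norm_num)
  have hA3' : HypA3 (cutoffWeight Ω (jOmega P.β Ω)) ψ ρ (P.flow g₀) a hh κ Ω R M := hA3
  -- smallness of `g₀`: exponential thresholds
  have he2 : Real.exp (-2) ≤ Real.exp (-1) := Real.exp_le_exp.2 (by norm_num)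
  have he1 : Real.exp (-2) ≤ 1 := by rw [← Real.exp_zero]; exact Real.exp_le_exp.2 (by norm_num)
  have hsmall1 : 4 * g₀ ≤ Real.exp (-1) := by linarith
  have hsmall2 : 2 * g₀ ≤ Real.exp (-2) := by linarith [Real.exp_pos (-2)]
  have hg1 : g₀ ≤ 1 := by linarith [Real.exp_pos (-2)]
  have h2g1 : 2 * g₀ ≤ 1 := by linarith
  -- the one-step ratio `ϑ ≤ Ωq₀`
  have hq1 : 1 < q₀ := one_lt_ratioMargin hΩ0 hκ hκΩ hR haStar
  have hq0 : 0 < q₀ := by linarith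
  have hcube : ((1 - 2 * B * g₀)⁻¹) ^ 3 ≤ q₀ := by
    refine inv_cube_le_of_small hB hg₀.le hq1.le ?_
    have h6 : 0 < 6 * B + 1 := by positivity
    have h7 := (le_div_iff₀ h6).1 hgr
    have e : g₀ * (6 * B + 1) = 6 * B * g₀ + g₀ := by ring
    linarith [hg₀.le]
  have hϑ : stepRatio Ω B g₀ ≤ Ω * q₀ := mul_le_mul_of_nonneg_left hcube hΩ0.le
  have hϑ0 : 0 ≤ stepRatio Ω B g₀ := h.stepRatio_nonneg
  have hq2 : q₀ ≤ 2 := (min_le_left _ _).trans (min_le_left _ _)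
  have hqR : q₀ ≤ (aStar - R) / (κ * aStar * Ω) := (min_le_left _ _).trans (min_le_right _ _)
  have hqκ : q₀ ≤ 1 + (1 - κ * Ω) / (4 * (κ * Ω)) := min_le_right _ _
  have hϑ2 : stepRatio Ω B g₀ ≤ 2 * Ω :=
    calc stepRatio Ω B g₀ ≤ Ω * q₀ := hϑ
      _ ≤ Ω * 2 := mul_le_mul_of_nonneg_left hq2 hΩ0.le
      _ = 2 * Ω := by ring
  have hϑR : R + κ * aStar * stepRatio Ω B g₀ ≤ aStar := by
    have hpos : 0 < κ * aStar * Ω := by positivity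
    have h1 : q₀ * (κ * aStar * Ω) ≤ aStar - R := (le_div_iff₀ hpos).1 hqR
    have h2 : κ * aStar * stepRatio Ω B g₀ ≤ κ * aStar * (Ω * q₀) :=
      mul_le_mul_of_nonneg_left hϑ (by positivity)
    have h3 : κ * aStar * (Ω * q₀) = q₀ * (κ * aStar * Ω) := by ring
    linarith
  have hϑκ : κ * stepRatio Ω B g₀ ≤ κ * Ω + (1 - κ * Ω) / 4 := by
    have hkΩ : 0 < κ * Ω := by positivity
    calc κ * stepRatio Ω B g₀ ≤ κ * (Ω * q₀) := mul_le_mul_of_nonneg_left hϑ hκ.le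
      _ = κ * Ω * q₀ := by ring
      _ ≤ κ * Ω * (1 + (1 - κ * Ω) / (4 * (κ * Ω))) := mul_le_mul_of_nonneg_left hqκ hkΩ.le
      _ = κ * Ω + (1 - κ * Ω) / 4 := by field_simp
  -- Lemma 1.3 along `x̄` and the ball data
  have hχ : ∀ j, 0 ≤ cutoffWeight Ω (jOmega P.β Ω) j := fun j => (h.weight_pos j).le
  have hgb : ∀ j, 0 ≤ P.flow g₀ j 0 := fun j => by rw [QuadFlowParams.flow_apply_zero]; exact (h.gbar_pos j).le
  have hKbar : ∀ j, ‖Kbar ψ (P.flow g₀) K₀ j‖ ≤ aStar * cutoffWeight Ω (jOmega P.β Ω) j * gbar P.β g₀ j ^ 3 := by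
    intro j
    have hratio : ∀ j, cutoffWeight Ω (jOmega P.β Ω) j * P.flow g₀ j 0 ^ 3 ≤
        stepRatio Ω B g₀ * (cutoffWeight Ω (jOmega P.β Ω) (j + 1) * P.flow g₀ (j + 1) 0 ^ 3) := fun j => by
      simpa [QuadFlowParams.flow_apply_zero, stepRatio] using h.toCutoffGbarHyp.weight_cube_le_mul_succ j
    have hK₀' : ‖K₀‖ ≤ aStar * cutoffWeight Ω (jOmega P.β Ω) 0 * P.flow g₀ 0 0 ^ 3 := by
      rw [cutoffWeight_eq_one_of_le (by simp), QuadFlowParams.flow_apply_zero, gbar_zero]; simpa using hK₀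
    have := hA3'.norm_Kbar_le hχ hgb hh0.le ha0.le ha.le hratio hϑR hK₀' j
    simpa [QuadFlowParams.flow_apply_zero] using this
  have hBall : CutoffQuadHyp.BallHyp P ψ Ω (jOmega P.β Ω) g₀ hh a aStar b K₀ :=
    ⟨hh0, hb, hb1.le, ha0.le, ha, hKbar, hsmall1, hsmall2⟩
  -- the solution operator and its norm
  set S := h.sbarVP hBall.small1 hBall.hh_pos with hS_def
  have hSn : ‖S‖ ≤ C' := h.norm_sbarVP_le hBall.small1 hBall.hh_pos
  -- `ε`-bounds
  have hε1 : epsLog g₀ ≤ 2 * Real.sqrt g₀ := epsLog_le_sqrt hg₀ hg1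
  have hε2 : epsLogSq g₀ ≤ 32 * Real.sqrt g₀ := by
    have h16 := epsLogSq_le_sqrt hg₀ h2g1
    have : Real.sqrt (2 * g₀) ≤ 2 * Real.sqrt g₀ := by
      rw [Real.sqrt_le_left (by positivity)]
      nlinarith [Real.sq_sqrt hg₀.le, Real.sqrt_nonneg g₀]
    linarith
  have hε10 := h.epsLog_nonneg; have hε20 := h.epsLogSq_nonneg
  have hsg0 : 0 ≤ Real.sqrt g₀ := Real.sqrt_nonneg _
  have hsq3 : Real.sqrt g₀ ≤ (1 - κ * Ω) * aK / (64 * M * hh) := by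
    have hx : 0 ≤ (1 - κ * Ω) * aK / (64 * M * hh) := by positivity
    calc Real.sqrt g₀ ≤ Real.sqrt (((1 - κ * Ω) * aK / (64 * M * hh)) ^ 2) := Real.sqrt_le_sqrt hg3
      _ = _ := Real.sqrt_sq hx
  set X : ℝ := 1 / (8 * (C' + 1) * (512 * (2 * B + 14 * C) * Ω * hh * b + 8 * M)) with hX
  have hBC : 0 ≤ 2 * B + 14 * C := by positivity
  have hden : 0 < 8 * (C' + 1) * (512 * (2 * B + 14 * C) * Ω * hh * b + 8 * M) := by positivity
  have hX0 : 0 ≤ X := by rw [hX]; positivity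
  have hsq4 : Real.sqrt g₀ ≤ X := by
    have : g₀ ≤ X ^ 2 := hg4.trans (by linarith [sq_nonneg X])
    calc Real.sqrt g₀ ≤ Real.sqrt (X ^ 2) := Real.sqrt_le_sqrt this
      _ = X := Real.sqrt_sq hX0
  -- the smallness conditions with `θ = θ₀ = (1 + κΩ)/2`
  have hθ0 : 0 ≤ θ₀ := by rw [hθ₀]; positivity
  have hθ1 : θ₀ < 1 := by rw [hθ₀]; linarith
  have hθhalf : 1 / 2 ≤ θ₀ := by
    have hk : 0 ≤ κ * Ω := by positivity
    rw [hθ₀]; linarith only [hk]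
  have hlipK : lipK Ω B g₀ κ M hh aK ≤ θ₀ := by
    unfold lipK
    have ht : 4 * M * epsLog g₀ * hh / aK ≤ (1 - κ * Ω) / 8 := by
      rw [div_le_iff₀ haK]
      calc 4 * M * epsLog g₀ * hh ≤ 4 * M * (2 * Real.sqrt g₀) * hh := by gcongr
        _ ≤ 4 * M * (2 * ((1 - κ * Ω) * aK / (64 * M * hh))) * hh := by gcongr
        _ = (1 - κ * Ω) / 8 * aK := by field_simp; ring
    rw [hθ₀]; linarith only [hϑκ, ht, h1κ]
  have hlipN : ‖S‖ * lipN Ω B C g₀ M hh aK b ≤ θ₀ := by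
    have hLN : 0 ≤ lipN Ω B C g₀ M hh aK b := by unfold lipN; positivity
    have t1 : C' * (M * aK * stepRatio Ω B g₀ / hh) ≤ 1 / 8 := by
      rw [mul_div_assoc', div_le_iff₀ hh0]
      calc C' * (M * aK * stepRatio Ω B g₀) ≤ C' * (M * aK * (2 * Ω)) := by gcongr
        _ = (16 * C' * M * aK * Ω) / 8 := by ring
        _ ≤ hh / 8 := by gcongr
        _ = 1 / 8 * hh := by ring
    have t2 : C' * (8 * (2 * B + 14 * C) * Ω * epsLogSq g₀ * hh * b + 4 * M * epsLog g₀) ≤ 1 / 8 := by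
      set Q : ℝ := (2 * B + 14 * C) * Ω * hh * b with hQ
      have hQ0 : 0 ≤ Q := by rw [hQ]; positivity
      have a1 : C' * (256 * Q + 8 * M) ≤ (C' + 1) * (512 * Q + 8 * M) :=
        mul_le_mul (by linarith) (by linarith) (by positivity) (by positivity)
      have hden' : 8 * (C' + 1) * (512 * Q + 8 * M) ≠ 0 := by positivity
      calc C' * (8 * (2 * B + 14 * C) * Ω * epsLogSq g₀ * hh * b + 4 * M * epsLog g₀)
          ≤ C' * (8 * (2 * B + 14 * C) * Ω * (32 * Real.sqrt g₀) * hh * b + 4 * M * (2 * Real.sqrt g₀)) := by gcongr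
        _ = C' * (256 * Q + 8 * M) * Real.sqrt g₀ := by rw [hQ]; ring
        _ ≤ (C' + 1) * (512 * Q + 8 * M) * X := mul_le_mul a1 hsq4 hsg0 (by positivity)
        _ = 1 / 8 := by
            rw [hX, show 512 * (2 * B + 14 * C) * Ω * hh * b = 512 * Q by rw [hQ]; ring]
            field_simp
    calc ‖S‖ * lipN Ω B C g₀ M hh aK b ≤ C' * lipN Ω B C g₀ M hh aK b := mul_le_mul_of_nonneg_right hSn hLN
      _ = C' * (M * aK * stepRatio Ω B g₀ / hh) +
          C' * (8 * (2 * B + 14 * C) * Ω * epsLogSq g₀ * hh * b + 4 * M * epsLog g₀) := by unfold lipN; ring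
      _ ≤ 1 / 8 + 1 / 8 := add_le_add t1 t2
      _ ≤ θ₀ := by linarith
  have hball : ‖S‖ * (M / hh) + θ₀ * b ≤ b := by
    have t : C' * (M / hh) ≤ (1 - κ * Ω) * b / 2 := by
      rw [mul_div_assoc', div_le_iff₀ hh0]
      have h1 := (div_le_iff₀ (by positivity : 0 < (1 - κ * Ω) * b)).1 hhB
      have e3 : (1 - κ * Ω) * b / 2 * hh = hh * ((1 - κ * Ω) * b) / 2 := by ring
      linarith
    have h2 : ‖S‖ * (M / hh) ≤ C' * (M / hh) := mul_le_mul_of_nonneg_right hSn (by positivity)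
    have e1 : θ₀ * b = b / 2 + κ * Ω * b / 2 := by rw [hθ₀]; ring
    have e2 : (1 - κ * Ω) * b / 2 = b / 2 - κ * Ω * b / 2 := by ring
    linarith
  have hSmall : CutoffQuadHyp.SmallHyp Ω B C g₀ κ M hh (a - aStar) b θ₀ S := ⟨hθ0, hθ1, hlipK, hlipN, hball⟩
  obtain ⟨x, hdom, hfl, hK0', hg0', tz, tμ, hbd⟩ := h.exists_perturbedFlow hA3' hBall hSmall
  refine ⟨x, hdom, hfl, hK0', hg0', tz, tμ, hbd, fun x' hfl' hK0'' hg0'' tz' tμ' hbd' => ?_⟩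
  exact (h.perturbedFlow_unique hA3' hBall hSmall hfl hK0' hg0' tz tμ hbd hfl' hK0'' hg0'' tz' tμ' hbd').symm


end CTWSAW

end Literature.Barriers.CriticalPhenomena
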